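import Mathlib
import Summits.AtomisticToContinuum.BoseEinsteinCondensation.Statement
import Summits.AtomisticToContinuum.BoseEinsteinCondensation.Theses.BECInfDivCoherence
import Summits.AtomisticToContinuum.BoseEinsteinCondensation.Theorems.BECInfDivCoherenceLevyNegativeMomentGridMeanLog
import Summits.AtomisticToContinuum.BoseEinsteinCondensation.Theorems.BECInfDivCoherenceGridAverageCondensate
import Summits.AtomisticToContinuum.BoseEinsteinCondensation.Theorems.BECInfDivCoherenceLevyNegativeMomentTargetStrengthGeneral

/-!
# Strategy census R1 for crux `LevyNegativeMoment` (stmt-AtomisticToContinuum-9115) — typed companion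

Planner crux-strategist `cstrat-stmt-AtomisticToContinuum-9115-r1` (second opinion, 2026-08-17).
Companion of `STRATEGY-CENSUS.md` (§R1).  Everything here is either a `Prop` (a typed piece / candidate)
or a sorry-free theorem assembled from landed supports of the route; nothing is claimed about the truth of
the crux.  Namespace disjoint from the s1 census (`…Strategist`) and from the lead's line (`…Birth`).

Contents
* `CruxClause v`            — the crux at ONE potential (body verbatim); `levyNegativeMoment_iff`.
* `PeriodicBECClause v`     — the route target T (= closed-as-moot item stmt-0826 `PeriodicBEC`) at one `v`;
  `PeriodicBECLocBdd`, `BECLocBdd` — T and the conjunct S on the class of profiles locally bounded on `(0,∞)`.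
* THE THEOREM THAT MAKES THE CRUX TARGET-STRENGTH (restated at census level, proofs = landed p163183 decls):
  `periodicBECLocBdd_of_crux : LevyNegativeMoment → PeriodicBECLocBdd`,
  `becLocBdd_of_crux_of_transfer : LevyNegativeMoment → BoundaryTransferWeak → BECLocBdd`.
* DECOMPOSITION ATTEMPT D1 (regime split by potential class): `CruxOn P`, assembly `crux_of_classSplit`
  (trivial seam), and `periodicBECLocBdd_of_cruxOn` — the locally-bounded piece ALONE is already ≥ T there.
* DECOMPOSITION ATTEMPT D2 (mass × shape of the Lévy weights): `LogMassBound` (uniform grid-mean floor of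
  `log G`), `ShapeTransfer`, assembly `crux_of_massShape`, `logMassBound_of_crux`, and
  `periodicBECLocBdd_of_logMassBound` — the mass piece ALONE is already ≥ T on the locally bounded class.
* TRANSFER ATTEMPT (information geometry): the only model-free tool of the Hellinger/affinity lever is the
  hinge `hinge_inner` (unit vectors: `⟪a,b⟫, ⟪b,c⟫ ≥ t ≥ 0 ⇒ ⟪a,c⟫ ≥ 2t² − 1`), proved here; it
  reformulates coherence floors as affinity floors and bounds nothing by itself (census §Transfer).
-/

noncomputable section

namespace Summit.AtomisticToContinuum.BoseEinsteinCondensation.Cruxes.LevyNegativeMoment.StrategistR1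

open scoped BigOperators ComplexConjugate ENNReal RealInnerProductSpace
open Filter MeasureTheory
open Literature.MathematicalPhysics.QuantumManyBody.BoseGas
open Summit.AtomisticToContinuum.BoseEinsteinCondensation.Theses.BECInfDivCoherence
  (LevyNegativeMoment BoundaryTransferWeak GridAverageCondensate)
open Summit.AtomisticToContinuum.BoseEinsteinCondensation.Theorems
open Summit.AtomisticToContinuum.BoseEinsteinCondensation.Theorems.InfDivGlue

/-! ### The crux at one potential -/

/-- The body of the crux at one potential `v` (verbatim after `IsRepulsiveFiniteRange v →`). -/
def CruxClause (v : ℝ → ℝ≥0∞) : Prop :=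
  ∀ η : ℝ, 0 < η → ∃ C : ℝ, ∃ ρ₀ : ℝ, 0 < ρ₀ ∧ ∀ ρ : ℝ, 0 < ρ → ρ < ρ₀ → ∀ᶠ N : ℕ in Filter.atTop, ∃ δ : ENNReal, 0 < δ ∧ ∀ Ψ : PeriodicTrialState N (sideLength ρ N), periodicEnergy v Ψ ≤ periodicGroundStateEnergy v N (sideLength ρ N) + δ → ∀ i : Fin N, let L : ℝ := sideLength ρ N; let m : ℕ := ⌊L / η⌋₊; let G : EuclideanSpace ℝ (Fin 3) → ℝ := fun r => (∫ X in cellN N L, conj (Ψ.ψ (Function.update X i (X i + r))) * Ψ.ψ X).re; let ν : (Fin 3 → Fin m) → ℝ := fun q => (∑ j : Fin 3 → Fin m, Real.log (G (latticeVec (L / m) (fun k => ((j k : ℕ) : ℤ)))) * Real.cos (2 * Real.pi * (∑ k, ((q k : ℕ) : ℝ) * ((j k : ℕ) : ℝ)) / m)) / (m : ℝ) ^ 3; (∑ q : Fin 3 → Fin m with (∃ k, (q k : ℕ) ≠ 0), max (ν q) 0 / (2 * Real.pi / L * Real.sqrt (∑ k, ((min (q k : ℕ) (m - (q k : ℕ))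 : ℕ) : ℝ) ^ 2))) ≤ C

/-- The crux is the conjunction of its clauses over admissible potentials (definitional). -/
theorem levyNegativeMoment_iff :
    LevyNegativeMoment ↔ ∀ v : ℝ → ℝ≥0∞, IsRepulsiveFiniteRange v → CruxClause v := Iff.rfl

/-! ### The route target T (PeriodicBEC, stmt-0826) and the conjunct on the locally bounded class -/

/-- T at one potential: constant-mode condensation of near-minimisers along `L = (N/ρ)^{1/3}` at all small
densities (the body of stmt-0826 `PeriodicBEC`, verbatim). -/
def PeriodicBECClause (v : ℝ → ℝ≥0∞) : Prop :=
  ∃ ρ₀ : ℝ, 0 < ρ₀ ∧ ∀ ρ : ℝ, 0 < ρ → ρ < ρ₀ →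
    ∃ c : ℝ, 0 < c ∧ ∀ᶠ N : ℕ in atTop, ∃ δ : ℝ≥0∞, 0 < δ ∧
      ∀ Ψ : PeriodicTrialState N (sideLength ρ N),
        periodicEnergy v Ψ ≤ periodicGroundStateEnergy v N (sideLength ρ N) + δ →
          ENNReal.ofReal (c * N) ≤ condensateOccupation N (sideLength ρ N) Ψ.ψ

/-- T = `PeriodicBEC` (stmt-0826, the target of ≥ 8 routes of this conjunct; LSSY2005 Ch. 5 (5.2)). -/
def PeriodicBEC : Prop := ∀ v : ℝ → ℝ≥0∞, IsRepulsiveFiniteRange v → PeriodicBECClause v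

/-- Profiles locally bounded on `(0,∞)` (all bounded and all soft cores; hard cores excluded). -/
def LocallyBoundedAway (v : ℝ → ℝ≥0∞) : Prop :=
  ∀ δ : ℝ, 0 < δ → ∃ M : ℝ≥0∞, M ≠ ⊤ ∧ ∀ r : ℝ, δ < r → v r ≤ M

/-- T on the locally bounded class (still the textbook open problem, LSSY2005 p. 35). -/
def PeriodicBECLocBdd : Prop :=
  ∀ v : ℝ → ℝ≥0∞, IsRepulsiveFiniteRange v → LocallyBoundedAway v → PeriodicBECClause v

/-- The conjunct S on the locally bounded class. -/
def BECLocBdd : Prop :=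
  ∀ v : ℝ → ℝ≥0∞, IsRepulsiveFiniteRange v → LocallyBoundedAway v →
    ∃ ρ₀ : ℝ, 0 < ρ₀ ∧ ∀ ρ : ℝ, 0 < ρ → ρ < ρ₀ → HasGroundStateBEC v ρ

/-- T ⟹ T on the subclass (bookkeeping). -/
theorem periodicBECLocBdd_of_periodicBEC (h : PeriodicBEC) : PeriodicBECLocBdd :=
  fun v hv _ => h v hv

/-! ### The theorem that makes the crux target-strength -/

/-- **The crux ALONE gives T for every admissible profile locally bounded on `(0,∞)`** — restatement at
census level of the landed `periodicBEC_clause_of_levyNegativeMoment_locallyBounded` (p163183). -/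
theorem periodicBECLocBdd_of_crux (h : LevyNegativeMoment) : PeriodicBECLocBdd :=
  fun _ hv hlb => periodicBEC_clause_of_levyNegativeMoment_locallyBounded h hv hlb

/-- **Crux + the route's own `BoundaryTransferWeak` (stmt-0827) give the conjunct's criterion on the
locally bounded class** — landed `hasGroundStateBEC_locallyBounded_of_levyNegativeMoment_of_boundaryTransferWeak`. -/
theorem becLocBdd_of_crux_of_transfer (h : LevyNegativeMoment) (h6 : BoundaryTransferWeak) : BECLocBdd :=
  hasGroundStateBEC_locallyBounded_of_levyNegativeMoment_of_boundaryTransferWeak h h6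

/-! ### Decomposition attempt D1 — regime split by potential class -/

/-- The crux restricted to a class `P` of potentials. -/
def CruxOn (P : (ℝ → ℝ≥0∞) → Prop) : Prop :=
  ∀ v : ℝ → ℝ≥0∞, IsRepulsiveFiniteRange v → P v → CruxClause v

/-- Assembly of the class split (trivial seam): the crux on `P` and on `¬P` give the crux. -/
theorem crux_of_classSplit (P : (ℝ → ℝ≥0∞) → Prop) (hA : CruxOn P) (hB : CruxOn fun v => ¬ P v) :
    LevyNegativeMoment := by
  rw [levyNegativeMoment_iff]
  intro v hv
  by_cases hp : P v
  · exact hA v hv hp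
  · exact hB v hv hp

/-- Per-potential form of c2's `gridMeanLog_of_levyNegativeMoment`: the crux clause at `v` bounds the grid
mean of `log G_Ψ` from below, uniformly (proof verbatim, localised at `v`). [folklore] -/
theorem gridMeanLog_clause_of_cruxClause {v : ℝ → ℝ≥0∞} (h2 : CruxClause v) :
    ∀ η : ℝ, 0 < η → ∃ Λ : ℝ, ∃ ρ₀ : ℝ, 0 < ρ₀ ∧
      ∀ ρ : ℝ, 0 < ρ → ρ < ρ₀ → ∀ᶠ N : ℕ in atTop, ∃ δ : ℝ≥0∞, 0 < δ ∧
        ∀ Ψ : PeriodicTrialState N (sideLength ρ N),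
          periodicEnergy v Ψ ≤ periodicGroundStateEnergy v N (sideLength ρ N) + δ → ∀ i : Fin N,
            let L : ℝ := sideLength ρ N; let m : ℕ := ⌊L / η⌋₊;
            -Λ ≤ (∑ j : Fin 3 → Fin m, Real.log ((∫ X in cellN N L,
              conj (Ψ.ψ (Function.update X i (X i + latticeVec (L / m) (fun k => ((j k : ℕ) : ℤ))))) *
                Ψ.ψ X).re)) / (m : ℝ) ^ 3 := by
  intro η hη
  obtain ⟨C, ρ₂, hρ₂, H2⟩ := h2 η hη
  refine ⟨2 * Real.sqrt 3 * Real.pi * max C 0 / η, ρ₂, hρ₂, fun ρ hρ hρ2 => ?_⟩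
  filter_upwards [H2 ρ hρ hρ2, eventually_gt_atTop 0] with N hN2 hN
  obtain ⟨δ, hδ, H⟩ := hN2
  have hNpos : (0 : ℝ) < N := by exact_mod_cast hN
  have hLpos : 0 < sideLength ρ N := by
    unfold sideLength; exact Real.rpow_pos_of_pos (div_pos hNpos hρ) _
  dsimp only at H ⊢
  generalize sideLength ρ N = L at H hLpos ⊢
  refine ⟨δ, hδ, fun Ψ hΨ i => ?_⟩
  have P := H Ψ hΨ i
  clear H H2
  have hmle : (⌊L / η⌋₊ : ℝ) ≤ L / η := Nat.floor_le (div_nonneg hLpos.le hη.le)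
  generalize ⌊L / η⌋₊ = m at P hmle ⊢
  have hΛ : 0 ≤ 2 * Real.sqrt 3 * Real.pi * max C 0 / η := by positivity
  rcases Nat.eq_zero_or_pos m with hm | hm
  · subst hm
    simp only [Finset.univ_eq_empty, Finset.sum_empty, zero_div]
    linarith
  haveI : NeZero m := ⟨hm.ne'⟩
  set G : Space → ℝ := fun r =>
    (∫ X in cellN N L, conj (Ψ.ψ (Function.update X i (X i + r))) * Ψ.ψ X).re with hGdef
  set F : (Fin 3 → Fin m) → ℝ := fun j =>
    Real.log (G (latticeVec (L / m) fun k => ((j k : ℕ) : ℤ))) with hFdef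
  have hF0 : F 0 = 0 := by
    have h0 : (latticeVec (L / m) fun k => (((0 : Fin 3 → Fin m) k : ℕ) : ℤ)) = 0 := by
      rw [← latticeVec_zero (L / m)]; congr 1
    show Real.log (G (latticeVec (L / m) fun k => (((0 : Fin 3 → Fin m) k : ℕ) : ℤ))) = 0
    rw [h0, hGdef]
    dsimp only
    rw [coh_zero Ψ i, Real.log_one]
  have P' : (∑ q : Fin 3 → Fin m with (∃ k, (q k : ℕ) ≠ 0),
      max ((∑ j : Fin 3 → Fin m, F j *
        Real.cos (2 * Real.pi * (∑ k, ((q k : ℕ) : ℝ) * ((j k : ℕ) : ℝ)) / m)) / (m : ℝ) ^ 3) 0 /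
      (2 * Real.pi / L * Real.sqrt (∑ k, ((min (q k : ℕ) (m - (q k : ℕ)) : ℕ) : ℝ) ^ 2))) ≤ C := P
  have key := neg_gridMean_le_of_negMoment hLpos F hF0 P'
  change -(2 * Real.sqrt 3 * Real.pi * max C 0 / η) ≤ (∑ j : Fin 3 → Fin m, F j) / (m : ℝ) ^ 3
  refine le_trans ?_ key
  rw [neg_le_neg_iff]
  have hmL : (m : ℝ) / L ≤ 1 / η := by
    rw [div_le_div_iff₀ hLpos hη, one_mul]
    rwa [le_div_iff₀ hη] at hmle
  calc 2 * Real.sqrt 3 * Real.pi * m / L * C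
      ≤ 2 * Real.sqrt 3 * Real.pi * m / L * max C 0 :=
        mul_le_mul_of_nonneg_left (le_max_left _ _) (by positivity)
    _ = 2 * Real.sqrt 3 * Real.pi * max C 0 * ((m : ℝ) / L) := by ring
    _ ≤ 2 * Real.sqrt 3 * Real.pi * max C 0 * (1 / η) :=
        mul_le_mul_of_nonneg_left hmL (by positivity)
    _ = 2 * Real.sqrt 3 * Real.pi * max C 0 / η := by ring

/-- **D1 fails to be short of the target: the locally-bounded piece ALONE is ≥ T on that class** (which is
the open problem in print): crux clause at `v` ⟹ grid-mean floor ⟹ (Faris–Simon positivity, proved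
`GridAverageCondensate`) constant-mode BEC at `v`. -/
theorem periodicBECLocBdd_of_cruxOn (hA : CruxOn LocallyBoundedAway) : PeriodicBECLocBdd :=
  fun v hv hlb => periodicBEC_clause_of_gridMeanLog_of_coherencePos hv
    (CoherencePosHC.coherencePos_of_locallyBounded v hv hlb)
    (gridMeanLog_clause_of_cruxClause (hA v hv hlb)) gridAverageCondensate_proof

/-! ### Decomposition attempt D2 — mass × shape of the Lévy weights -/

/-- MASS piece: a uniform (in `N` and `ρ < ρ₀`) floor `−Λ(v,η)` of the grid mean of `log G_Ψ` for
near-minimisers ("BEC at the level of `log G`"; the conclusion of c2's `gridMeanLog_of_levyNegativeMoment`). -/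
def LogMassBound : Prop :=
  ∀ v : ℝ → ℝ≥0∞, IsRepulsiveFiniteRange v → ∀ η : ℝ, 0 < η → ∃ Λ : ℝ, ∃ ρ₀ : ℝ, 0 < ρ₀ ∧
    ∀ ρ : ℝ, 0 < ρ → ρ < ρ₀ → ∀ᶠ N : ℕ in atTop, ∃ δ : ℝ≥0∞, 0 < δ ∧
      ∀ Ψ : PeriodicTrialState N (sideLength ρ N),
        periodicEnergy v Ψ ≤ periodicGroundStateEnergy v N (sideLength ρ N) + δ → ∀ i : Fin N,
          let L : ℝ := sideLength ρ N; let m : ℕ := ⌊L / η⌋₊;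
          -Λ ≤ (∑ j : Fin 3 → Fin m, Real.log ((∫ X in cellN N L,
            conj (Ψ.ψ (Function.update X i (X i + latticeVec (L / m) (fun k => ((j k : ℕ) : ℤ))))) *
              Ψ.ψ X).re)) / (m : ℝ) ^ 3

/-- SHAPE piece (bridge form): given the total Lévy mass floor, the `(−1)`-moment is bounded — i.e. no
infrared concentration of the Lévy weights of near-minimisers. -/
def ShapeTransfer : Prop := LogMassBound → LevyNegativeMoment

/-- Assembly of D2 (trivial seam). -/
theorem crux_of_massShape (h1 : LogMassBound) (h2 : ShapeTransfer) : LevyNegativeMoment := h2 h1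

/-- The crux gives the mass piece (c2, landed p147933). -/
theorem logMassBound_of_crux (h : LevyNegativeMoment) : LogMassBound := gridMeanLog_of_levyNegativeMoment h

/-- **D2 fails to be short of the target: the MASS piece ALONE is ≥ T on the locally bounded class.** -/
theorem periodicBECLocBdd_of_logMassBound (h : LogMassBound) : PeriodicBECLocBdd :=
  fun v hv hlb => periodicBEC_clause_of_gridMeanLog_of_coherencePos hv
    (CoherencePosHC.coherencePos_of_locallyBounded v hv hlb) (h v hv) gridAverageCondensate_proof

/-! ### Transfer attempt (information geometry) — the hinge is the only model-free tool, and it only reformulates -/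

/-- **Hinge inequality.** For unit vectors `a b c` of a real inner product space with `⟪a,b⟫ ≥ t` and
`⟪b,c⟫ ≥ t ≥ 0` one has `⟪a,c⟫ ≥ 2t² − 1`.  (Applied to `a = Ψ(·+r eᵢ)`, `c = Ψ`, `b` = the partial
symmetrisation in `xᵢ`, it turns an affinity floor `Ā ≥ t` into the coherence floor `G(r) ≥ 2t² − 1` and
conversely nothing: census §Transfer.) [folklore] -/
theorem hinge_inner {E : Type*} [NormedAddCommGroup E] [InnerProductSpace ℝ E] {a b c : E}
    (ha : ‖a‖ = 1) (hb : ‖b‖ = 1) (hc : ‖c‖ = 1) {t : ℝ} (ht : 0 ≤ t)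
    (hab : t ≤ ⟪a, b⟫) (hbc : t ≤ ⟪b, c⟫) : 2 * t ^ 2 - 1 ≤ ⟪a, c⟫ := by
  set p : ℝ := ⟪a, b⟫ with hp
  set q : ℝ := ⟪b, c⟫ with hq
  have hbb : ⟪b, b⟫ = (1 : ℝ) := by rw [real_inner_self_eq_norm_sq, hb, one_pow]
  have haa : ⟪a, a⟫ = (1 : ℝ) := by rw [real_inner_self_eq_norm_sq, ha, one_pow]
  have hcc : ⟪c, c⟫ = (1 : ℝ) := by rw [real_inner_self_eq_norm_sq, hc, one_pow]
  have hba : ⟪b, a⟫ = p := real_inner_comm a b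
  have hcb : ⟪c, b⟫ = q := real_inner_comm b c
  set a' : E := a - p • b with ha'
  set c' : E := c - q • b with hc'
  have h4 : ⟪a', c'⟫ = ⟪a, c⟫ - p * q := by
    simp only [ha', hc', inner_sub_left, inner_sub_right, real_inner_smul_left, real_inner_smul_right,
      hbb, ← hq]
    ring
  have h2 : ‖a'‖ ^ 2 = 1 - p ^ 2 := by
    rw [← real_inner_self_eq_norm_sq]
    simp only [ha', inner_sub_left, inner_sub_right, real_inner_smul_left, real_inner_smul_right,
      hba, hbb, haa, ← hp]
    ring
  have h3 : ‖c'‖ ^ 2 = 1 - q ^ 2 := by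
    rw [← real_inner_self_eq_norm_sq]
    simp only [hc', inner_sub_left, inner_sub_right, real_inner_smul_left, real_inner_smul_right,
      hcb, hbb, hcc, ← hq]
    ring
  have h1 : -(‖a'‖ * ‖c'‖) ≤ ⟪a', c'⟫ := by
    have h := abs_real_inner_le_norm a' c'
    have h' := neg_abs_le (⟪a', c'⟫ : ℝ)
    linarith
  have hpq : t * t ≤ p * q := mul_le_mul hab hbc ht (ht.trans hab)
  nlinarith [sq_nonneg (‖a'‖ - ‖c'‖), norm_nonneg a', norm_nonneg c', hpq, h1, h2, h3, h4]

end Summit.AtomisticToContinuum.BoseEinsteinCondensation.Cruxes.LevyNegativeMoment.StrategistR1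

end
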